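import Literature.AlgebraicTopology.SingularHomology.UniverseTransportCap
import Literature.AlgebraicTopology.SingularHomology.FundamentalClassExistence
import Literature.AlgebraicTopology.SingularHomology.UniversalCoefficientsProofs
import Literature.AlgebraicTopology.SingularHomology.IntersectionForm
import HarnessLib

/-!
# Orientations, fundamental classes, the Kronecker pairing, the cup product and the connecting
# homomorphism along homeomorphisms across universes

For a homeomorphism `e : X ≃ₜ Y` between spaces `X : Type u`, `Y : Type u'` in *different*
universes, `…UniverseTransportIso` and `…UniverseTransportCap` construct the comparison
equivalences of singular homology, relative homology, local homology and cohomology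
(`singularHomology.xEquiv`, `relativeSingularHomology.xEquiv`, `localHomology.xEquiv`,
`singularCohomology.xEquiv`; A. Hatcher, *Algebraic Topology* (2002), §2.1 and §3.1: a
homeomorphism induces isomorphisms) together with their naturality for maps (of pairs) and the
relative cap product.  This file adds the compatibilities needed to move *oriented* statements —
`R`-orientations, fundamental classes, intersection forms, and oriented bordism data
`(W, w ∈ Hₙ₊₁(W, ∂W), ∂w = [∂W])` — between universes:

* `relativeSingularHomology.xEquiv_ofAbsolute`, `localHomology.xEquiv_toLocal` — `j_*` (and
  `Hₙ(X) → Hₙ(X | x)`) commutes with the comparison equivalences (Hatcher §2.1, naturality of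
  the sequence of the pair);
* `HomologicalOrientation.exists_xEquiv_localClass_eq` — **an `R`-orientation of `Y` transports
  to an `R`-orientation of `X`** with corresponding local classes (Hatcher §3.3 p. 235);
  `singularHomology.xEquiv_fundamentalClass` — **the fundamental classes of closed manifolds then
  correspond** (Hatcher Thm. 3.26, by uniqueness, `IsFundamentalClass.fundamentalClass_eq_holds`);
* `kroneckerPairing_xEquiv` — `⟨e^* b, z⟩ = ⟨b, e_* z⟩` (Hatcher §3.1 p. 201), through the
  evaluation formula `kroneckerPairing_π_homologyπ` (`…UniversalCoefficientsProofs`) read in the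
  concrete model (`kroneckerPairing_π_compIso_hom_homologyCls`);
* `singularCohomology.xEquiv_cupProduct` — `e^*(a ⌣ b) = e^* a ⌣ e^* b` (Hatcher §3.2,
  Prop. 3.10), from the Alexander–Whitney formula and `SingularSimplex.push_frontFace/backFace`;
* `cupPairing_xEquiv`, `equivalent_intersectionForm_of_xEquiv` — **the cup product pairing and
  the intersection form `Q_X` (on cohomology modulo torsion) of closed oriented manifolds are
  invariant under orientation-respecting homeomorphisms across universes** (Milnor–Husemoller
  1973, §V.1; the one-universe version is `equivalent_intersectionForm_comap`,
  `…IntersectionForm`);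
* `relativeSingularHomology.xEquiv_δ` — **the connecting homomorphism `∂ : Hₙ₊₁(X, A) → Hₙ(A)`
  commutes with the comparison equivalences** (Hatcher §2.1, Thm. 2.16, `∂[x] = [∂x]`, and the
  naturality of `∂`), through `δ_concreteIso_inv_relCls` (`…RelativeCapProduct`).

Client: `Literature/Topology/FourManifolds/BordismFourUniverse.lean` (the `Ω₄^SO ≅ ℤ` cluster —
Kirby 1989 Cor. IX.2, Thom 1954 Thm IV.13, `spc4.S36` — at universe `0` implies it at every
universe).  Everything is proved; no definitions and no named facts are introduced (the
transported orientation is provided existentially).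

## References

* A. Hatcher, *Algebraic Topology*, CUP 2002, §2.1 (pp. 111, 127), Thm. 2.16, §3.1 p. 201,
  §3.2 Prop. 3.10, §3.3 p. 235–236, Thm. 3.26, Cor. 3.39. [HatcherAT2002]
* J. Milnor, D. Husemoller, *Symmetric Bilinear Forms*, Springer 1973, §V.1. [MilnorHusemoller1973]

## Design notes

* As in `…UniverseTransportIso` / `…UniverseTransportCap`, `backward.isDefEq.respectTransparency`
  is turned off (chains of the concrete complex are `Finsupp`s up to unfolding).
* No declaration in this file uses `sorry`.
-/

noncomputable section

-- as in `SingularChainsConcrete` / `UniverseTransportIso`: chains of the concrete complex are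
-- `Finsupp`s up to unfolding of semireducible definitions
set_option backward.isDefEq.respectTransparency false

open CategoryTheory Limits Set

universe u u' v

namespace Literature.AlgebraicTopology.SingularHomology

variable (R : Type v) [CommRing R] (M : Type v) [AddCommGroup M] [Module R M]
variable {X : Type u} {Y : Type u'} [TopologicalSpace X] [TopologicalSpace Y]

/-! ### `j_*` and the comparison equivalences -/

namespace relativeSingularHomology

/-- `j_*` on the image of a concrete class: `concreteIso (j_* (compIso [w])) = [w]` as a relative
class. [folklore] -/
lemma concreteIso_hom_ofAbsolute_compIso_hom_homologyCls {A : Set X} (n : ℕ)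
    (w : (csingularChainComplex R M X).X n)
    (hw : (csingularChainComplex R M X).d n ((ComplexShape.down ℕ).next n) w = 0) :
    (concreteIso R M X A n).hom (ofAbsolute R M X A n ((csingularHomology.compIso R M X n).hom
        (homologyCls w hw))) =
      (chainsInSub R M X A).relCls w (by rw [hw]; exact Submodule.zero_mem _) := by
  rw [← ModuleCat.comp_apply, ofAbsolute_comp_concreteIso_hom, ModuleCat.comp_apply,
    Iso.hom_inv_id_apply, Subcomplex.homologyMap_π_homologyCls]

/-- **`j_*` commutes with the comparison equivalences across universes**: for `e : X ≃ₜ Y` with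
`e(A) = B`, `xEquiv e (j_* c) = j_* (xEquiv e c)` (Hatcher 2002, §2.1, naturality of the exact
sequence of the pair). [cite: HatcherAT2002, §2.1] -/
theorem xEquiv_ofAbsolute (e : X ≃ₜ Y) {A : Set X} {B : Set Y} (hAB : MapsTo e A B)
    (hBA : MapsTo e.symm B A) (n : ℕ) (c : singularHomology R M X n) :
    xEquiv R M e hAB hBA n (ofAbsolute R M X A n c) =
      ofAbsolute R M Y B n (singularHomology.xEquiv R M e n c) := by
  obtain ⟨z, hz, rfl⟩ := homologyCls_surjective c
  -- the absolute class read in the concrete model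
  set w := (csingularChainComplex.compIso R M X).inv.f n z with hw
  have hwd : (csingularChainComplex R M X).d n ((ComplexShape.down ℕ).next n) w = 0 :=
    d_hom_f_eq_zero _ z hz
  have hcls : homologyCls z hz = (csingularHomology.compIso R M X n).hom (homologyCls w hwd) := by
    rw [← csingularHomology.compIso_inv_homologyCls, Iso.inv_hom_id_apply]
  rw [hcls]
  -- left-hand side
  have e1 : ofAbsolute R M X A n ((csingularHomology.compIso R M X n).hom (homologyCls w hwd)) =
      (concreteIso R M X A n).inv ((chainsInSub R M X A).relCls w
        (by rw [hwd]; exact Submodule.zero_mem _)) := by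
    rw [← concreteIso_hom_ofAbsolute_compIso_hom_homologyCls, Iso.hom_inv_id_apply]
  have hpush : (csingularChainComplex R M Y).d n ((ComplexShape.down ℕ).next n)
      (CChain.push R M (e : C(X, Y)) n w) = 0 := by
    have hc := (csingularChainComplex.xEquiv R M e).comm n ((ComplexShape.down ℕ).next n) w
    rw [csingularChainComplex.xEquiv_e_apply, csingularChainComplex.xEquiv_e_apply] at hc
    rw [← hc, hwd, map_zero]
  rw [e1, xEquiv_concreteIso_inv_relCls e hAB hBA n w _ (by rw [hpush]; exact Submodule.zero_mem _)]
  -- right-hand side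
  have e2 : singularHomology.xEquiv R M e n ((csingularHomology.compIso R M X n).hom (homologyCls w hwd)) =
      (csingularHomology.compIso R M Y n).hom (homologyCls (CChain.push R M (e : C(X, Y)) n w) hpush) := by
    simp only [singularHomology.xEquiv, LinearEquiv.trans_apply, Iso.toLinearEquiv_apply,
      Iso.symm_hom]
    rw [Iso.hom_inv_id_apply, csingularHomology.xEquiv_homologyCls R M e n w hwd hpush]
  rw [e2, ← concreteIso_hom_ofAbsolute_compIso_hom_homologyCls, Iso.hom_inv_id_apply]

end relativeSingularHomology

/-- **`Hₙ(X) → Hₙ(X | x)` commutes with the comparison equivalences across universes**: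
`xEquiv e (c|ₓ) = (xEquiv e c)|_{e x}` (Hatcher 2002, §3.3, naturality). [cite: HatcherAT2002, §3.3 p. 236] -/
theorem localHomology.xEquiv_toLocal (e : X ≃ₜ Y) (x : X) (n : ℕ) (c : singularHomology R M X n) :
    localHomology.xEquiv R M e x n (singularHomology.toLocal R M x n c) =
      singularHomology.toLocal R M (e x) n (singularHomology.xEquiv R M e n c) :=
  relativeSingularHomology.xEquiv_ofAbsolute R M e _ _ n c

/-! ### Orientations and fundamental classes across universes -/

namespace HomologicalOrientation

variable {R}

/-- **Transport of an `R`-orientation along a homeomorphism across universes** (Hatcher 2002,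
§3.3: orientations are natural under homeomorphisms): for `e : X ≃ₜ Y` and an orientation `μ`
of `Y` there is an orientation `μ'` of `X` whose local class at `x` corresponds to `μ_{e x}`
under `Hₙ(X | x) ≃ Hₙ(Y | e x)` (`localHomology.xEquiv`). [cite: HatcherAT2002, §3.3 p. 235] -/
theorem exists_xEquiv_localClass_eq {n : ℕ} (e : X ≃ₜ Y) (μ : HomologicalOrientation R Y n) :
    ∃ μ' : HomologicalOrientation R X n,
      ∀ x, localHomology.xEquiv R R e x n (μ'.localClass x) = μ.localClass (e x) := by
  refine ⟨{ localClass := fun x => (localHomology.xEquiv R R e x n).symm (μ.localClass (e x))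
            isGenerator := fun x => ?_
            locallyConsistent := fun x => ?_ }, fun x => LinearEquiv.apply_symm_apply _ _⟩
  · obtain ⟨f, hf⟩ := μ.isGenerator (e x)
    exact ⟨(localHomology.xEquiv R R e x n).trans f, by simp [hf]⟩
  · obtain ⟨K, hK, μK, hμK⟩ := μ.locallyConsistent (e x)
    refine ⟨e ⁻¹' K, e.continuous.continuousAt.preimage_mem_nhds hK,
      (localHomologyOfSet.xEquiv R R e (e ⁻¹' K) n).symm
        (restrictLocal R R (image_preimage_subset e K) n μK), fun y hy => ?_⟩
    apply (localHomology.xEquiv R R e y n).injective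
    rw [LinearEquiv.apply_symm_apply, localHomology.xEquiv_restrictToPoint,
      LinearEquiv.apply_symm_apply, restrictToPoint, ← ModuleCat.comp_apply, restrictLocal_comp]
    exact hμK (e y) hy

end HomologicalOrientation

/-- **Fundamental classes correspond under the comparison equivalences across universes**
(Hatcher 2002, Thm. 3.26, naturality): if the orientations `μ'` of `X` and `μ` of `Y` correspond
along `e : X ≃ₜ Y`, then `xEquiv e [X]_{μ'} = [Y]_μ` for closed manifolds `X`, `Y`.
[cite: HatcherAT2002, Thm. 3.26] -/
theorem singularHomology.xEquiv_fundamentalClass {n : ℕ} [CompactSpace X] [T2Space X]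
    [ChartedSpace (EuclideanSpace ℝ (Fin n)) X] [CompactSpace Y] [T2Space Y]
    [ChartedSpace (EuclideanSpace ℝ (Fin n)) Y] (e : X ≃ₜ Y)
    {μ' : HomologicalOrientation R X n} {μ : HomologicalOrientation R Y n}
    (hμ : ∀ x, localHomology.xEquiv R R e x n (μ'.localClass x) = μ.localClass (e x)) :
    singularHomology.xEquiv R R e n μ'.fundamentalClass = μ.fundamentalClass := by
  symm
  apply IsFundamentalClass.fundamentalClass_eq_holds R Y n
  intro y
  obtain ⟨x, rfl⟩ := e.surjective y
  rw [← localHomology.xEquiv_toLocal, ← hμ x,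
    HomologicalOrientation.isFundamentalClass_fundamentalClass_holds n μ' x]

/-! ### The Kronecker pairing across universes -/

/-- **Evaluation formula in the concrete model**: for a cocycle `a` and a concrete cycle `w`,
`⟨[a], compIso [w]⟩ = ∑_σ w(σ) · a(σ)` (Hatcher 2002, §3.1, p. 191). [cite: HatcherAT2002, §3.1 p. 191] -/
lemma kroneckerPairing_π_compIso_hom_homologyCls {n : ℕ} (a : singularCochainComplex.cocycles R R X n)
    (w : (csingularChainComplex R R X).X n)
    (hw : (csingularChainComplex R R X).d n ((ComplexShape.down ℕ).next n) w = 0) :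
    kroneckerPairing R R X n (singularCohomology.π R R X n a)
        ((csingularHomology.compIso R R X n).hom (homologyCls w hw)) =
      Finsupp.linearCombination R (singularCochainComplex.iCocycles R R X n a : SingularSimplex X n → R) w := by
  -- `compIso [w] = [compIso w]`, a class of Mathlib's model
  have hz : (singularChainComplex R R X).d n ((ComplexShape.down ℕ).next n)
      ((csingularChainComplex.compIso R R X).hom.f n w) = 0 :=
    d_hom_f_eq_zero (csingularChainComplex.compIso R R X).hom w hw
  have h1 : (csingularHomology.compIso R R X n).hom (homologyCls w hw) =
      homologyCls ((csingularChainComplex.compIso R R X).hom.f n w) hz :=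
    homologyMap_homologyCls _ w hw
  have hi : singularChainComplex.iCycles R R X n
      ((singularChainComplex R R X).cyclesMk ((csingularChainComplex.compIso R R X).hom.f n w)
        ((ComplexShape.down ℕ).next n) rfl hz) = (csingularChainComplex.compIso R R X).hom.f n w :=
    (singularChainComplex R R X).i_cyclesMk _ _ _ _
  have hc : (csingularChainComplex.compInv R R X n).hom ((csingularChainComplex.compIso R R X).hom.f n w) = w := by
    change ((csingularChainComplex.compIsoX R R X n).hom ≫ (csingularChainComplex.compIsoX R R X n).inv) w = w
    rw [Iso.hom_inv_id]
    rfl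
  rw [h1, homologyCls_eq_homologyπ_cyclesMk _ hz ((ComplexShape.down ℕ).next n) rfl hz,
    kroneckerPairing_π_homologyπ, LinearMap.comp_apply, hi, hc]

/-- **The Kronecker pairing commutes with the comparison equivalences across universes**:
`⟨e^* b, z⟩_X = ⟨b, e_* z⟩_Y` for `e : X ≃ₜ Y`, `b ∈ Hⁿ(Y; R)`, `z ∈ Hₙ(X; R)` (Hatcher 2002,
§3.1 p. 201, naturality of the Kronecker pairing). [cite: HatcherAT2002, §3.1 p. 201] -/
theorem kroneckerPairing_xEquiv (e : X ≃ₜ Y) (n : ℕ) (b : singularCohomology R R Y n)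
    (z : singularHomology R R X n) :
    kroneckerPairing R R X n (singularCohomology.xEquiv R R e n b) z =
      kroneckerPairing R R Y n b (singularHomology.xEquiv R R e n z) := by
  induction b using singularCohomology_induction_on with
  | h a =>
  -- the class `z` in the concrete model
  obtain ⟨z, hz, rfl⟩ := homologyCls_surjective z
  set w := (csingularChainComplex.compIso R R X).inv.f n z with hw
  have hwd : (csingularChainComplex R R X).d n ((ComplexShape.down ℕ).next n) w = 0 :=
    d_hom_f_eq_zero _ z hz
  have hcls : homologyCls z hz = (csingularHomology.compIso R R X n).hom (homologyCls w hwd) := by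
    rw [← csingularHomology.compIso_inv_homologyCls, Iso.inv_hom_id_apply]
  rw [hcls]
  have hpush : (csingularChainComplex R R Y).d n ((ComplexShape.down ℕ).next n)
      (CChain.push R R (e : C(X, Y)) n w) = 0 := by
    have hc := (csingularChainComplex.xEquiv R R e).comm n ((ComplexShape.down ℕ).next n) w
    rw [csingularChainComplex.xEquiv_e_apply, csingularChainComplex.xEquiv_e_apply] at hc
    rw [← hc, hwd, map_zero]
  have e2 : singularHomology.xEquiv R R e n ((csingularHomology.compIso R R X n).hom (homologyCls w hwd)) =
      (csingularHomology.compIso R R Y n).hom (homologyCls (CChain.push R R (e : C(X, Y)) n w) hpush) := by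
    simp only [singularHomology.xEquiv, LinearEquiv.trans_apply, Iso.toLinearEquiv_apply,
      Iso.symm_hom]
    rw [Iso.hom_inv_id_apply, csingularHomology.xEquiv_homologyCls R R e n w hwd hpush]
  -- a cocycle of `X` with underlying cochain `a ∘ e♯`
  set a' : singularCochainComplex.cocycles R R X n := singularCochainComplex.cocyclesMk
    ((singularCochainComplex.xEquiv R R e).e n (singularCochainComplex.iCocycles R R Y n a)) (by
      rw [← (singularCochainComplex.xEquiv R R e).comm]
      have h0 : (singularCochainComplex R R Y).d n (n + 1) (singularCochainComplex.iCocycles R R Y n a) = 0 := by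
        rw [← ModuleCat.comp_apply, HomologicalComplex.iCycles_d]
        rfl
      rw [h0, map_zero]) with ha'
  have hia' : singularCochainComplex.iCocycles R R X n a' =
      (singularCochainComplex.xEquiv R R e).e n (singularCochainComplex.iCocycles R R Y n a) :=
    singularCochainComplex.iCocycles_mk _ _
  rw [singularCohomology.xEquiv_π R R e n a a' hia', e2, kroneckerPairing_π_compIso_hom_homologyCls,
    kroneckerPairing_π_compIso_hom_homologyCls, hia']
  change _ = Finsupp.linearCombination R _ (Finsupp.mapDomain (SingularSimplex.push (e : C(X, Y))) w)
  rw [Finsupp.linearCombination_mapDomain]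
  rfl

/-! ### The cup product across universes -/

/-- The Alexander–Whitney product commutes with `φ ↦ φ ∘ e♯` on cochains (Hatcher 2002, §3.2,
proof of Prop. 3.10: `f♯(φ ⌣ ψ) = f♯φ ⌣ f♯ψ`). [cite: HatcherAT2002, §3.2 Prop. 3.10] -/
lemma singularCochainComplex.xEquiv_e_cochainCup (e : X ≃ₜ Y) {p q n : ℕ} (h : p + q = n)
    (φ : SingularSimplex Y p → R) (ψ : SingularSimplex Y q → R) :
    (singularCochainComplex.xEquiv R R e).e n (cochainCup h φ ψ) =
      cochainCup h ((singularCochainComplex.xEquiv R R e).e p φ)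
        ((singularCochainComplex.xEquiv R R e).e q ψ) := by
  funext σ
  rw [singularCochainComplex.xEquiv_e_apply, cochainCup_apply, cochainCup_apply,
    singularCochainComplex.xEquiv_e_apply, singularCochainComplex.xEquiv_e_apply,
    SingularSimplex.push_frontFace, SingularSimplex.push_backFace]

/-- **The cup product commutes with the comparison equivalences across universes**:
`e^*(a ⌣ b) = e^*a ⌣ e^*b` for `e : X ≃ₜ Y` (Hatcher 2002, §3.2, Prop. 3.10, naturality of the
cup product). [cite: HatcherAT2002, §3.2 Prop. 3.10] -/
theorem singularCohomology.xEquiv_cupProduct (e : X ≃ₜ Y) {p q n : ℕ} (h : p + q = n)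
    (a : singularCohomology R R Y p) (b : singularCohomology R R Y q) :
    singularCohomology.xEquiv R R e n (cupProduct h a b) =
      cupProduct h (singularCohomology.xEquiv R R e p a) (singularCohomology.xEquiv R R e q b) := by
  induction a using singularCohomology_induction_on with
  | h a =>
  induction b using singularCohomology_induction_on with
  | h b =>
  obtain ⟨a', ha'⟩ := singularCohomology.xEquiv_surjective_π R R e p
    (singularCochainComplex.cocyclesMk ((singularCochainComplex.xEquiv R R e).e p
      (singularCochainComplex.iCocycles R R Y p a)) (by
      rw [← (singularCochainComplex.xEquiv R R e).comm, singularCochainComplex.d_iCocycles, map_zero]))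
  -- cocycles of `X` representing `e^* a`, `e^* b`, `e^* (a ⌣ b)`
  have hda : (singularCochainComplex R R X).d p (p + 1) ((singularCochainComplex.xEquiv R R e).e p
      (singularCochainComplex.iCocycles R R Y p a)) = 0 := by
    rw [← (singularCochainComplex.xEquiv R R e).comm, singularCochainComplex.d_iCocycles, map_zero]
  have hdb : (singularCochainComplex R R X).d q (q + 1) ((singularCochainComplex.xEquiv R R e).e q
      (singularCochainComplex.iCocycles R R Y q b)) = 0 := by
    rw [← (singularCochainComplex.xEquiv R R e).comm, singularCochainComplex.d_iCocycles, map_zero]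
  have hdab : (singularCochainComplex R R X).d n (n + 1) ((singularCochainComplex.xEquiv R R e).e n
      (singularCochainComplex.iCocycles R R Y n (singularCochainComplex.cocyclesCup h a b))) = 0 := by
    rw [← (singularCochainComplex.xEquiv R R e).comm, singularCochainComplex.d_iCocycles, map_zero]
  rw [cupProduct_π_π,
    singularCohomology.xEquiv_π R R e p a (singularCochainComplex.cocyclesMk _ hda)
      (singularCochainComplex.iCocycles_mk _ _),
    singularCohomology.xEquiv_π R R e q b (singularCochainComplex.cocyclesMk _ hdb)
      (singularCochainComplex.iCocycles_mk _ _),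
    singularCohomology.xEquiv_π R R e n (singularCochainComplex.cocyclesCup h a b)
      (singularCochainComplex.cocyclesMk _ hdab) (singularCochainComplex.iCocycles_mk _ _),
    cupProduct_π_π]
  congr 1
  refine singularCochainComplex.cocycles_ext ?_
  rw [singularCochainComplex.iCocycles_mk, singularCochainComplex.iCocycles_cocyclesCup,
    singularCochainComplex.iCocycles_cocyclesCup, singularCochainComplex.iCocycles_mk,
    singularCochainComplex.iCocycles_mk, singularCochainComplex.xEquiv_e_cochainCup]

/-! ### The cup product pairing and the intersection form across universes -/

/-- **The cup product pairing across universes**: if the orientations `μ'` of `X` and `μ` of `Y`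
correspond along `e : X ≃ₜ Y` (closed manifolds), then `⟨e^*a ⌣ e^*b, [X]⟩ = ⟨a ⌣ b, [Y]⟩`
(Hatcher 2002, §3.3, naturality of cup product, Kronecker pairing and fundamental class).
[cite: HatcherAT2002, §3.3 Cor. 3.39] -/
theorem cupPairing_xEquiv {n p q : ℕ} [CompactSpace X] [T2Space X]
    [ChartedSpace (EuclideanSpace ℝ (Fin n)) X] [CompactSpace Y] [T2Space Y]
    [ChartedSpace (EuclideanSpace ℝ (Fin n)) Y] (e : X ≃ₜ Y)
    {μ' : HomologicalOrientation R X n} {μ : HomologicalOrientation R Y n}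
    (hμ : ∀ x, localHomology.xEquiv R R e x n (μ'.localClass x) = μ.localClass (e x))
    (h : p + q = n) (a : singularCohomology R R Y p) (b : singularCohomology R R Y q) :
    cupPairing μ' h (singularCohomology.xEquiv R R e p a) (singularCohomology.xEquiv R R e q b) =
      cupPairing μ h a b := by
  rw [cupPairing_apply, cupPairing_apply, ← singularCohomology.xEquiv_cupProduct,
    kroneckerPairing_xEquiv, singularHomology.xEquiv_fundamentalClass R e hμ]

/-- **The intersection form is invariant under homeomorphisms across universes**: if the
`ℤ`-orientations `μ'` of `X` and `μ` of `Y` correspond along `e : X ≃ₜ Y` (closed manifolds of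
dimension `n = k + k`), then `Q_{X, μ'} ≅ Q_{Y, μ}` (isometric), the isometry being induced by
`e^*` on cohomology modulo torsion (Milnor–Husemoller 1973, §V.1; Gompf–Stipsicz 1999, §1.2).
[cite: MilnorHusemoller1973, §V.1] -/
theorem equivalent_intersectionForm_of_xEquiv {k n : ℕ} [CompactSpace X] [T2Space X]
    [ChartedSpace (EuclideanSpace ℝ (Fin n)) X] [CompactSpace Y] [T2Space Y]
    [ChartedSpace (EuclideanSpace ℝ (Fin n)) Y] (e : X ≃ₜ Y)
    {μ' : HomologicalOrientation ℤ X n} {μ : HomologicalOrientation ℤ Y n}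
    (hμ : ∀ x, localHomology.xEquiv ℤ ℤ e x n (μ'.localClass x) = μ.localClass (e x))
    (h : k + k = n) :
    (intersectionForm h μ').Equivalent (intersectionForm h μ) := by
  -- `e^*` on cohomology modulo torsion
  set E := singularCohomology.xEquiv ℤ ℤ e k with hE
  have hT : (Submodule.torsion ℤ ↥(singularCohomology ℤ ℤ Y k)).map (E : _ →ₗ[ℤ] _) =
      Submodule.torsion ℤ ↥(singularCohomology ℤ ℤ X k) := by
    refine le_antisymm (Submodule.map_le_iff_le_comap.2 (freeCohomology.torsion_le_comap_torsion _)) fun x hx => ?_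
    refine ⟨E.symm x, ?_, E.apply_symm_apply x⟩
    exact Submodule.mem_comap.1 (freeCohomology.torsion_le_comap_torsion E.symm.toLinearMap hx)
  let L : ↥(freeCohomology ℤ Y k) ≃ₗ[ℤ] ↥(freeCohomology ℤ X k) :=
    Submodule.Quotient.equiv _ _ E hT
  have hL : ∀ a, L (freeCohomology.mk a) = freeCohomology.mk (E a) := fun a => rfl
  refine ⟨LinearMap.BilinForm.IsometryEquiv.symm { toLinearEquiv := L, map_app' := fun x y => ?_ }⟩
  induction x using freeCohomology.induction_on with
  | h a =>
  induction y using freeCohomology.induction_on with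
  | h b =>
  change intersectionForm h μ' (L (freeCohomology.mk a)) (L (freeCohomology.mk b)) = _
  rw [hL, hL, intersectionForm_mk_mk, intersectionForm_mk_mk, hE, cupPairing_xEquiv ℤ e hμ]


/-! ### The connecting homomorphism across universes -/

namespace relativeSingularHomology

/-- **The connecting homomorphism commutes with the comparison equivalences across universes**:
for `e : X ≃ₜ Y` with `e(A) = B` and the restricted homeomorphism `e_A : A ≃ₜ B`,
`(e_A)_* (∂ w) = ∂ (e_* w)` for `w ∈ Hₙ₊₁(X, A; M)` (Hatcher 2002, §2.1, Thm. 2.16 and the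
naturality of `∂`, p. 127). [cite: HatcherAT2002, §2.1 p. 127] -/
theorem xEquiv_δ (e : X ≃ₜ Y) {A : Set X} {B : Set Y} (hAB : MapsTo e A B)
    (hBA : MapsTo e.symm B A) (eA : A ≃ₜ B) (heA : ∀ a : A, (eA a : Y) = e a) (n : ℕ)
    (w : relativeSingularHomology R M X A (n + 1)) :
    singularHomology.xEquiv R M eA n (δ R M X A n w) =
      δ R M Y B n (xEquiv R M e hAB hBA (n + 1) w) := by
  obtain ⟨z', rfl⟩ := (ModuleCat.epi_iff_surjective (concreteIso R M X A (n + 1)).inv).mp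
    inferInstance w
  obtain ⟨x, hx, rfl⟩ := (chainsInSub R M X A).relCls_surjective z'
  -- a chain `y` of `↥A` pushing forward to `∂x`
  have hx' : (csingularChainComplex R M X).d (n + 1) n x ∈ chainsIn R M X A n := by
    rw [ChainComplex.next_nat_succ] at hx
    exact hx
  rw [← range_lmapDomain_val] at hx'
  obtain ⟨y, hy⟩ := hx'
  have hy' : (csingularChainComplex.map R M (⟨Subtype.val, continuous_subtype_val⟩ : C(A, X))).f n y =
      (csingularChainComplex R M X).d (n + 1) n x := hy
  -- its push-forward `e_A♯ y` pushes forward to `∂(e♯ x)`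
  have hval : ∀ a : A, (⟨Subtype.val, continuous_subtype_val⟩ : C(B, Y)) (eA a) =
      e ((⟨Subtype.val, continuous_subtype_val⟩ : C(A, X)) a) := heA
  have hdx : CChain.push R M (e : C(X, Y)) n ((csingularChainComplex R M X).d (n + 1) n x) =
      (csingularChainComplex R M Y).d (n + 1) n (CChain.push R M (e : C(X, Y)) (n + 1) x) := by
    have hc := (csingularChainComplex.xEquiv R M e).comm (n + 1) n x
    rw [csingularChainComplex.xEquiv_e_apply, csingularChainComplex.xEquiv_e_apply] at hc
    exact hc
  have hy'' : (csingularChainComplex.map R M (⟨Subtype.val, continuous_subtype_val⟩ : C(B, Y))).f n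
      (CChain.push R M (eA : C(A, B)) n y) =
        (csingularChainComplex R M Y).d (n + 1) n (CChain.push R M (e : C(X, Y)) (n + 1) x) := by
    rw [← csingularChainComplex.push_map_f R M eA e _ _ hval n y, hy', hdx]
  have hpx : (csingularChainComplex R M Y).d (n + 1) ((ComplexShape.down ℕ).next (n + 1))
      (CChain.push R M (e : C(X, Y)) (n + 1) x) ∈ chainsInSub R M Y B ((ComplexShape.down ℕ).next (n + 1)) :=
    d_push_mem e hAB (n + 1) x hx
  rw [xEquiv_concreteIso_inv_relCls e hAB hBA (n + 1) x hx hpx,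
    δ_concreteIso_inv_relCls B _ hpx _ hy'', δ_concreteIso_inv_relCls A x hx y hy']
  -- both sides are `compIso [e_A♯ y]`
  have hyd : (csingularChainComplex R M A).d n ((ComplexShape.down ℕ).next n) y = 0 :=
    d_eq_zero_of_map_val_eq_d A x y hy'
  have hpyd : (csingularChainComplex R M B).d n ((ComplexShape.down ℕ).next n)
      (CChain.push R M (eA : C(A, B)) n y) = 0 :=
    d_eq_zero_of_map_val_eq_d B _ _ hy''
  have e1 : (csingularHomology.compIso R M A n).hom (homologyCls y hyd) =
      homologyCls ((csingularChainComplex.compIso R M A).hom.f n y) (d_hom_f_eq_zero (csingularChainComplex.compIso R M A).hom y hyd) := by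
    change HomologicalComplex.homologyMap (csingularChainComplex.compIso R M A).hom n (homologyCls y hyd) = _
    exact homologyMap_homologyCls (csingularChainComplex.compIso R M A).hom y hyd
  have e2 : (csingularHomology.compIso R M B n).hom (homologyCls (CChain.push R M (eA : C(A, B)) n y) hpyd) =
      homologyCls ((csingularChainComplex.compIso R M B).hom.f n (CChain.push R M (eA : C(A, B)) n y))
        (d_hom_f_eq_zero (csingularChainComplex.compIso R M B).hom _ hpyd) := by
    change HomologicalComplex.homologyMap (csingularChainComplex.compIso R M B).hom n (homologyCls _ hpyd) = _
    exact homologyMap_homologyCls (csingularChainComplex.compIso R M B).hom _ hpyd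
  rw [homologyCls_congr rfl _ (d_hom_f_eq_zero (csingularChainComplex.compIso R M A).hom y hyd), ← e1,
    homologyCls_congr rfl _ (d_hom_f_eq_zero (csingularChainComplex.compIso R M B).hom _ hpyd), ← e2]
  simp only [singularHomology.xEquiv, LinearEquiv.trans_apply, Iso.toLinearEquiv_apply, Iso.symm_hom]
  rw [Iso.hom_inv_id_apply, csingularHomology.xEquiv_homologyCls R M eA n y hyd hpyd]

end relativeSingularHomology

end Literature.AlgebraicTopology.SingularHomology

end
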